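import Summits.CriticalPhenomena.PercolationContinuityZ3.Theorems.Transplant.SkelPhiNegReachCorridor
import Summits.CriticalPhenomena.PercolationContinuityZ3.Theorems.Transplant.SkelPhiNegReachTargets
import Summits.CriticalPhenomena.PercolationContinuityZ3.Theorems.Transplant.SkelPhiNegReachDeep
import Summits.CriticalPhenomena.PercolationContinuityZ3.Theorems.Transplant.SkelPhiNegReachExcess
import Summits.CriticalPhenomena.PercolationContinuityZ3.Theorems.Transplant.SkelPhiConcReachRun
import HarnessLib

/-!
# N1 (the `{±1}` node), (C) column file (C-A7): `Skel.ReachOblRHN` FOR THE N1 SCHEME OF RECORD, RUN FORM — the ∀-assembly over run histories of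
# `⟨cellGeomSG₂ G F P t (concRadii2N P gap gap' E₀ L' off), q, δc⟩` (fine cell map `F = fineSkel φ t …`, hp-8; radius schedule with column slot,
# stmt-g13) from: the two-frame corridor of record per probe `(y, du)` (v-rounds `P₁` over `F` about `cen y` ⟶ frame change at the column vertex
# `cOf α y` ⟶ u-rounds `P₂` ⧺ signed band `B du` over `runX φ (cOf α y) n h 1`; `reachOblAtHN_negCorridor`, C-A3), the realised radii
# (`reach_radii_concSG₂N`), deep entrances (`deep_of_run₂`), the rim excess (`real_rim_le_concSG₂`), the true targets (`coreTF₁/₂_nonempty`,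
# `exists_mem_span_runX_eq`), the run-frame rooms from reading inequalities (`room₂/B/L_of_rd`) — with the per-step KIT CLAUSES of the two frames as
# the hypotheses `hkitsR₁` (windows over `F`) and `hkitsR₂` (windows over `runX`), p1's port.  N1 twin of `Skelφ.reachOblRH_of_schedules` (D″).

builds on p205010 (kernel theorem, internal audit signed; external expert review pending) — nothing in this file uses p205010; nothing here is a
claim about the open node `SamePDropOfSkeletonNeg`.
Lane `prim-bschramm`, seat `prim-bschramm-p5` (gen 8; (C) lineage); helper file (`--supports stmt-CriticalPhenomena-4575`).

* **`Skelφ.reachOblRHN_negSG₂`**.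
[cite: KozmaNitzan2024, §4 Lemma 12 (pp. 23–25), p. 26 ((29)), p. 30 (Step IV), p. 31] [cite: MartineauTassion2017, §4.3 Lemma 4.2]
-/

noncomputable section

open MeasureTheory

namespace Summit.CriticalPhenomena.PercolationContinuityZ3.Theorems

namespace Transplant

namespace Skelφ

open Literature.Probability.Percolation Literature.Probability.LatticeModels SimpleGraph GadgetSystem ProbeHistory HSiteScheme Contour KNCells
open KNCells.KSchA KNLevels ChainPlanar ChainPara
open Literature.Probability.Percolation.GM
open Literature.Probability.Percolation.KozmaNitzan.Cells (oth sgOf sgOf_sign stepVec_apply_fst stepVec_apply_oth)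
open Literature.Barriers.CriticalPhenomena (graphBall graphBall_finite mem_graphBall_self graphBall_mono)
open BoxProdZ2 (ConcRadiiG nQ nS Erad Frad Erad_mono Frad_succ Frad_le_Erad Erad_add_gap_le_Frad_succ add_mul_le_Erad)
open TwoAxis.Para (modulus)
open Skel (excess winGraphIn winGraphIn_le ReachOblAtHN ReachOblRHN l1_tgt_le_nQ)

open scoped Classical

variable {V : Type} [DecidableEq V] {G : SimpleGraph V} [G.LocallyFinite] {φ : V → Site 2}

/-- **`Skel.ReachOblRHN` FOR THE N1 SCHEME OF RECORD FROM THE TWO-FRAME CORRIDORS** (see the module docstring for the inputs; the kit clauses of the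
two frames are the last two hypotheses, stated after the `let`s). [cite: KozmaNitzan2024, §4 Lemma 12 (pp. 23–25), p. 30 (Step IV), p. 31] -/
theorem reachOblRHN_negSG₂ [Countable V] (hstep : Steps G φ) (hlipφ : Lip G φ) {t : V} {A : ℤ} (hA : 0 < A) {n : ℕ} (hn : 1 ≤ n)
    {h vα vβ : ℤ} (hm : 0 < modulus n h vα vβ) {c₀' c₁' s₀ s₁ D : ℤ} (hc₀' : 0 < c₀') (hc₁' : 0 < c₁') (hD : 0 < D)
    {kq : ℕ} (hκ : h.natAbs ≤ kq * n)
    (F : V → Site 2) (hFdef : F = fineSkel φ t A n h vα vβ c₀' c₁' s₀ s₁ D) (hlipF : Lip G F) (hws : WeakSteps G F) (hF0 : F t = 0)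
    (P : PCells2) (gap gap' : ℕ → ℕ) (E₀ L' : ℕ) (off : Site 2 → ℕ) (q : unitInterval) (δc : ℝ)
    (hΛ : WFS2 P (concRadii2N P gap gap' E₀ L' off)) (hgap : ∀ m, 20 * P.rmax ≤ gap m) {c : ℕ} (hgapc : ∀ m, c ≤ gap m)
    (hoff : ∀ x : Site 2, off x ≤ c * ((x 0).natAbs + (x 1).natAbs) + 1) (hE₀ : 3 ≤ E₀) (hgapL : ∀ ρ, L' ≤ gap ρ)
    (hcol : ∀ a x, ∃ y ∈ VWin G F t (P.Q x) ((concRadii2N P gap gap' E₀ L' off).rQ a x), F y = P.cen x)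
    -- the column vertices of the frame change
    (cOf : ℕ → Site 2 → V) (hcF : ∀ a y, F (cOf a y) = P.cen y)
    (hcQ : ∀ a y, cOf a y ∈ VWin G F t (P.Q y) ((concRadii2N P gap gap' E₀ L' off).rQ a y))
    {cC dC : ℕ} (hcD : ∀ a (y : Site 2), cOf a y ∈ graphBall G t (cC * ((y 0).natAbs + (y 1).natAbs) + dC)) (hgapC : ∀ m, cC ≤ gap m)
    -- segment 1: the v-rounds and their rooms
    (P₁ : LocPrm) (hP₁ : LocOK P₁) (z : ℕ)
    (h3r₁ : 3 * (P.r 1 : ℤ) ≤ P₁.L0) (h3r₀ : 3 * (P.r 0 : ℤ) ≤ P₁.W)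
    (h5r₁ : max (P₁.L0 : ℤ) P₁.sHi + P₁.e + P₁.La ≤ 5 * (P.r 1 : ℤ)) (h5r₀ : P₁.Wk P₁.N + P₁.e + P₁.Lb ≤ 5 * (P.r 0 : ℤ))
    {K₀ K₁ : ℕ} (hcoreK : ∀ y : Site 2, (P₁.scheduleNz 1 (P.cen y) hP₁ z).core (P₁.N + 1) ⊆
      Finset.Icc (P.cen y - ![(K₀ : ℤ), K₁]) (P.cen y + ![(K₀ : ℤ), K₁]))
    -- segment 2: the u-rounds, the signed band per direction, the joins
    (P₂ : LocPrm) (hP₂ : LocOK P₂) (B : MDir → RunPrm) (hB : ∀ du, RunOK (B du)) (heb : ∀ du, (B du).eb = (B du).ea)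
    (hR' : ∀ du, (B du).ea = P₂.e)
    (hjoin : ∀ du, (P₂.scheduleN 0 0 hP₂).core (P₂.N + 1) ⊆ ((B du).scheduleN du.1 (sgOf_sign du) 0 (hB du) (heb du)).core 0)
    (hreg : ∀ du, ((B du).scheduleN du.1 (sgOf_sign du) 0 (hB du) (heb du)).core 0 ⊆ (P₂.scheduleN 0 0 hP₂).region P₂.N)
    -- the cross link
    {Bx : ℤ} (ha : D * (c₁' * (n : ℤ) * (K₀ + 1) + c₀' * |vα| * (K₁ + 1)) ≤ c₀' * c₁' * A * modulus n h vα vβ * P₂.L0)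
    (hBx : D * ((K₁ : ℤ) + 1) ≤ c₁' * A * Bx) (hb : Bx / (shearUnit n h : ℤ) + 1 ≤ P₂.W)
    -- the run-frame rooms as reading inequalities
    (hrd₂ : ∀ du : MDir, ∀ k ≤ P₂.N,
      let lo := dLo 0 1 0 (-(P₂.L k + P₂.e + P₂.La)) (P₂.L k + P₂.e + P₂.La) (-(P₂.Wk k + P₂.e + P₂.Lb)) (P₂.Wk k + P₂.e + P₂.Lb)
      let hi := dHi 0 1 0 (-(P₂.L k + P₂.e + P₂.La)) (P₂.L k + P₂.e + P₂.La) (-(P₂.Wk k + P₂.e + P₂.Lb)) (P₂.Wk k + P₂.e + P₂.Lb)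
      (sgOf du = 1 → -(5 * (P.r du.1 : ℤ)) ≤ rdLo A n h vα vβ c₀' c₁' D lo hi du.1 ∧ rdHi A n h vα vβ c₀' c₁' D lo hi du.1 ≤ 22 * (P.r du.1 : ℤ)) ∧
      (sgOf du = -1 → -(5 * (P.r du.1 : ℤ)) ≤ -rdHi A n h vα vβ c₀' c₁' D lo hi du.1 ∧ -rdLo A n h vα vβ c₀' c₁' D lo hi du.1 ≤ 22 * (P.r du.1 : ℤ)) ∧
      (-(2 * (P.r (oth du.1) : ℤ)) ≤ rdLo A n h vα vβ c₀' c₁' D lo hi (oth du.1) ∧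
        rdHi A n h vα vβ c₀' c₁' D lo hi (oth du.1) ≤ 2 * (P.r (oth du.1) : ℤ)))
    (hrdB : ∀ du : MDir, ∀ j ≤ (B du).N,
      let lo := dLo du.1 (sgOf du) 0 ((B du).aLo j - (B du).ea - (B du).La) ((B du).aHi j + (B du).ea + (B du).La)
        ((B du).bLo j - (B du).eb - (B du).Lb) ((B du).bHi j + (B du).eb + (B du).Lb)
      let hi := dHi du.1 (sgOf du) 0 ((B du).aLo j - (B du).ea - (B du).La) ((B du).aHi j + (B du).ea + (B du).La)
        ((B du).bLo j - (B du).eb - (B du).Lb) ((B du).bHi j + (B du).eb + (B du).Lb)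
      (sgOf du = 1 → -(5 * (P.r du.1 : ℤ)) ≤ rdLo A n h vα vβ c₀' c₁' D lo hi du.1 ∧ rdHi A n h vα vβ c₀' c₁' D lo hi du.1 ≤ 22 * (P.r du.1 : ℤ)) ∧
      (sgOf du = -1 → -(5 * (P.r du.1 : ℤ)) ≤ -rdHi A n h vα vβ c₀' c₁' D lo hi du.1 ∧ -rdLo A n h vα vβ c₀' c₁' D lo hi du.1 ≤ 22 * (P.r du.1 : ℤ)) ∧
      (-(2 * (P.r (oth du.1) : ℤ)) ≤ rdLo A n h vα vβ c₀' c₁' D lo hi (oth du.1) ∧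
        rdHi A n h vα vβ c₀' c₁' D lo hi (oth du.1) ≤ 2 * (P.r (oth du.1) : ℤ)))
    (hrdL : ∀ du : MDir,
      let lo := dLo du.1 (sgOf du) 0 ((B du).aLo ((B du).N + 1)) ((B du).aHi ((B du).N + 1)) ((B du).bLo ((B du).N + 1)) ((B du).bHi ((B du).N + 1))
      let hi := dHi du.1 (sgOf du) 0 ((B du).aLo ((B du).N + 1)) ((B du).aHi ((B du).N + 1)) ((B du).bLo ((B du).N + 1)) ((B du).bHi ((B du).N + 1))
      (sgOf du = 1 → 17 * (P.r du.1 : ℤ) + 1 ≤ rdLo A n h vα vβ c₀' c₁' D lo hi du.1 ∧ rdHi A n h vα vβ c₀' c₁' D lo hi du.1 ≤ 22 * (P.r du.1 : ℤ)) ∧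
      (sgOf du = -1 → 17 * (P.r du.1 : ℤ) + 1 ≤ -rdHi A n h vα vβ c₀' c₁' D lo hi du.1 ∧ -rdLo A n h vα vβ c₀' c₁' D lo hi du.1 ≤ 22 * (P.r du.1 : ℤ)) ∧
      (-(2 * (P.r (oth du.1) : ℤ)) ≤ rdLo A n h vα vβ c₀' c₁' D lo hi (oth du.1) ∧
        rdHi A n h vα vβ c₀' c₁' D lo hi (oth du.1) ≤ 2 * (P.r (oth du.1) : ℤ)))
    -- the band's habitat points
    (zB : MDir → ℕ → Site 2) (hzB : ∀ du j, 1 ≤ j → j ≤ (B du).N + 1 → zB du j ∈ (B du).pcore du.1 (sgOf du) 0 j) {Zmax : ℕ}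
    (hZ : ∀ du j, ((zB du j) 0).natAbs + ((zB du j) 1).natAbs ≤ Zmax)
    (hrdZ : ∀ du j,
      (sgOf du = 1 → -(5 * (P.r du.1 : ℤ)) + 1 ≤ rdLo A n h vα vβ c₀' c₁' D (zB du j) (zB du j) du.1 ∧
        rdHi A n h vα vβ c₀' c₁' D (zB du j) (zB du j) du.1 ≤ 22 * (P.r du.1 : ℤ) - 1) ∧
      (sgOf du = -1 → -(5 * (P.r du.1 : ℤ)) + 1 ≤ -rdHi A n h vα vβ c₀' c₁' D (zB du j) (zB du j) du.1 ∧
        -rdLo A n h vα vβ c₀' c₁' D (zB du j) (zB du j) du.1 ≤ 22 * (P.r du.1 : ℤ) - 1) ∧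
      (-(2 * (P.r (oth du.1) : ℤ)) + 1 ≤ rdLo A n h vα vβ c₀' c₁' D (zB du j) (zB du j) (oth du.1) ∧
        rdHi A n h vα vβ c₀' c₁' D (zB du j) (zB du j) (oth du.1) ≤ 2 * (P.r (oth du.1) : ℤ) - 1))
    (hE₀Z : dC + (kq + 3) * Zmax + 3 ≤ E₀)
    {nmax : ℕ} (hlen : ∀ du, P₁.N + 1 + (P₂.N + 1 + (B du).N) ≤ nmax)
    -- kit constants, count, excess radius
    {Rlev Nk j₀ j₁ : ℕ} (hRl₁ : Rlev + 1 ≤ P₁.e - z) (hRl₂ : Rlev + 1 ≤ P₂.e) (hj : j₁ ≤ Rlev)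
    {Δ' : ℕ} {δ η : ℝ} (hcount : 1 / (1 - (q : ℝ)) ^ (Δ' * Nk) ≤ δ * ((Finset.Icc j₀ j₁).card : ℝ)) (hη : η ≤ δ / 2)
    {Rex : ℕ → ℕ}
    (hRex : ∀ R₀' R₁, Rex R₀' ≤ R₁ → ∀ (Rw : ℕ) (D' A' : Finset V), (∀ d ∈ D', d ∈ graphBall G t Rw) →
      (∀ d ∈ D', ∀ d' ∈ D', F d - F d' ∈ box 2 (50 * P.rmax)) → A' ⊆ D' → (∀ a ∈ A', a ∈ graphBall G t R₀') →
        (bondPercolation G q).real (excess G t R₁ D' A') ≤ η)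
    (hsch : ∀ g, Rex (Erad gap gap' E₀ g + 1) + L' ≤ Erad gap gap' E₀ (g + 1)) :
    let Λ := concRadii2N P gap gap' E₀ L' off
    let S : KSchA V ℕ := ⟨cellGeomSG₂ G F P t Λ, q, δc⟩
    let FD := faceDataSG G F P t Λ
    -- the kit clauses of the two frames at every run, for the window-chain records whose rims cover the far vertices
    (∀ (ω : BondConfig V) (m : ℕ) (e : Site 2 × MDir),
      (S.astOf₂ G (S.hst₂ G ω m)).st.choice = some e → S.Valid₂ G (S.hst₂ G ω m) e → ∀ du ∈ S.onward G (S.hst₂ G ω m) (tgt e),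
      let Ω := S.Γ.Ewv (S.aOf₁ G (S.hst₂ G ω m) e) e.1 e.2 ∪ FD.Hfull (S.aOf₂ G (S.hst₂ G ω m) e) (tgt e) du
      let S₁f := (P₁.scheduleNz 1 (P.cen (tgt e)) hP₁ z).toFrame
      ∀ Pd : WinChainData V,
      Pd.o = t → Pd.Sfin = S.Sx G (S.hst₂ G ω m) e (S.aOf₁ G (S.hst₂ G ω m) e) (S.aOf₂ G (S.hst₂ G ω m) e) du →
      Pd.Rlev = Rlev → Pd.N = Nk → Pd.j₀ = j₀ → Pd.j₁ = j₁ →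
      (∀ k, ∀ v ∈ (planarWindowIn hlipF Ω).stepDF S₁f k,
        v ∉ graphBall G t (Erad gap gap' E₀ (nQ (S.aOf₁ G (S.hst₂ G ω m) e) (tgt e)) - L') → v ∈ Pd.Rim k) →
      ∀ k ≤ S₁f.N, ∀ j ∈ Finset.Icc Pd.j₀ Pd.j₁, ∃ (σ : SData V) (Sz : Finset V),
      SHyp (Pd.stepLF (planarWindowIn hlipF Ω) S₁f k) j σ ∧ σ.N ≤ Pd.N ∧
      (1 - (q : ℝ) ^ σ.sB) ^ σ.k ≤ δ ∧ Sz ⊆ (Pd.stepLF (planarWindowIn hlipF Ω) S₁f k).X j ∧ Sz ⊆ (planarWindowIn hlipF Ω).stepDF S₁f k ∧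
      (∀ x ∈ σ.K, ∀ e' ∈ σ.seed x, e' ∉ wireSet (↑Sz : Set V)) ∧ (∀ x ∈ σ.K, σ.face x ⊆ Sz) ∧
      (∀ x ∈ σ.K, 1 - 3 * δ ≤ (prodBernoulli (S.Wcor G FD (S.hst₂ G ω m) e (S.aOf₁ G (S.hst₂ G ω m) e) (S.aOf₂ G (S.hst₂ G ω m) e) du)).real
        {ω' | ∃ u ∈ σ.face x, 1 - δ < (prodBernoulli (pinW (S.Wcor G FD (S.hst₂ G ω m) e (S.aOf₁ G (S.hst₂ G ω m) e)
          (S.aOf₂ G (S.hst₂ G ω m) e) du) (wireSet (↑Sz : Set V)) ω')).real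
          (⋃ t' ∈ Pd.coreEF (planarWindowIn hlipF Ω) S₁f k, openConnIn (↑((planarWindowIn hlipF Ω).stepDF S₁f k) : Set V) u t')})) →
    (∀ (ω : BondConfig V) (m : ℕ) (e : Site 2 × MDir),
      (S.astOf₂ G (S.hst₂ G ω m)).st.choice = some e → S.Valid₂ G (S.hst₂ G ω m) e → ∀ du ∈ S.onward G (S.hst₂ G ω m) (tgt e),
      let Ω := S.Γ.Ewv (S.aOf₁ G (S.hst₂ G ω m) e) e.1 e.2 ∪ FD.Hfull (S.aOf₂ G (S.hst₂ G ω m) e) (tgt e) du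
      let S₂f := (corrRunSchedS P₂ hP₂ (B du) du.1 (sgOf_sign du) (hB du) (heb du) (hR' du) (hjoin du) (hreg du)).toFrame
      let hlipR : Lip G (runX φ (cOf (S.aOf₁ G (S.hst₂ G ω m) e) (tgt e)) n h 1) :=
        lip_runX hlipφ (Or.inl rfl) hn (cOf (S.aOf₁ G (S.hst₂ G ω m) e) (tgt e)) h
      ∀ Pd : WinChainData V,
      Pd.o = t → Pd.Sfin = S.Sx G (S.hst₂ G ω m) e (S.aOf₁ G (S.hst₂ G ω m) e) (S.aOf₂ G (S.hst₂ G ω m) e) du →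
      Pd.Rlev = Rlev → Pd.N = Nk → Pd.j₀ = j₀ → Pd.j₁ = j₁ →
      (∀ k, ∀ v ∈ (planarWindowIn hlipR Ω).stepDF S₂f k,
        v ∉ graphBall G t (Erad gap gap' E₀ (nQ (S.aOf₁ G (S.hst₂ G ω m) e) (tgt e)) - L') → v ∈ Pd.Rim k) →
      ∀ k ≤ S₂f.N, ∀ j ∈ Finset.Icc Pd.j₀ Pd.j₁, ∃ (σ : SData V) (Sz : Finset V),
      SHyp (Pd.stepLF (planarWindowIn hlipR Ω) S₂f k) j σ ∧ σ.N ≤ Pd.N ∧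
      (1 - (q : ℝ) ^ σ.sB) ^ σ.k ≤ δ ∧ Sz ⊆ (Pd.stepLF (planarWindowIn hlipR Ω) S₂f k).X j ∧ Sz ⊆ (planarWindowIn hlipR Ω).stepDF S₂f k ∧
      (∀ x ∈ σ.K, ∀ e' ∈ σ.seed x, e' ∉ wireSet (↑Sz : Set V)) ∧ (∀ x ∈ σ.K, σ.face x ⊆ Sz) ∧
      (∀ x ∈ σ.K, 1 - 3 * δ ≤ (prodBernoulli (S.Wcor G FD (S.hst₂ G ω m) e (S.aOf₁ G (S.hst₂ G ω m) e) (S.aOf₂ G (S.hst₂ G ω m) e) du)).real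
        {ω' | ∃ u ∈ σ.face x, 1 - δ < (prodBernoulli (pinW (S.Wcor G FD (S.hst₂ G ω m) e (S.aOf₁ G (S.hst₂ G ω m) e)
          (S.aOf₂ G (S.hst₂ G ω m) e) du) (wireSet (↑Sz : Set V)) ω')).real
          (⋃ t' ∈ Pd.coreEF (planarWindowIn hlipR Ω) S₂f k, openConnIn (↑((planarWindowIn hlipR Ω).stepDF S₂f k) : Set V) u t')})) →
    ReachOblRHN G nmax S FD Δ' δ := by
  intro Λ S FD hkitsR₁ hkitsR₂ hist e hrun hc hV du hdu
  subst hFdef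
  obtain ⟨ω, m, rfl⟩ := hrun
  have hE₀1 : 1 ≤ E₀ := by omega
  -- the radii at the realised triple
  obtain ⟨hEQ, hBE, hρ, -, hM, hgen⟩ := reach_radii_concSG₂N (P := P) (t := t) (gap := gap) (gap' := gap') (E₀ := E₀) (L' := L') (off := off)
    (q := q) (δc := δc) hgap hgapc hoff hE₀1 hF0 hc hV hdu
  set α := S.aOf₁ G (S.hst₂ G ω m) e with hαdef
  set β := S.aOf₂ G (S.hst₂ G ω m) e with hβdef
  set y := tgt e with hydef
  set E := Erad gap gap' E₀ (nQ α y) with hEdef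
  have hBle : Λ.rB α e.1 e.2 ≤ E := le_of_eq hBE
  have hρle : ∀ ℓ, Λ.ρ β y du ℓ ≤ E := fun ℓ => by rw [hρ ℓ]; exact Nat.sub_le _ _
  -- the onward direction is not the way back
  have hdur : du ≠ rev e.2 := by
    rintro rfl
    obtain ⟨y', hy', hyc⟩ := hV.src_mem
    have h1 := (Finset.mem_filter.1 hdu).2 y' hy'
    rw [show tgt e + stepVec (rev e.2) = e.1 from tgt_tgt_rev e] at h1
    exact h1 hyc
  -- the depth rooms: `E ≥ E₀ + cC‖y‖₁` dominates the column vertex and the band points, `ρ = E − 2`, `rM = F(nQ+1) − L' ≥ E − 1`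
  have hl1 : (y 0).natAbs + (y 1).natAbs ≤ nQ α y := l1_tgt_le_nQ₂ _ hc
  have hdrift : E₀ + cC * nQ α y ≤ E := Erad_linear gap' E₀ hgapC _
  have hmul : cC * ((y 0).natAbs + (y 1).natAbs) ≤ cC * nQ α y := Nat.mul_le_mul_left _ hl1
  have hZj : ∀ j, (kq + 3) * (((zB du j) 0).natAbs + ((zB du j) 1).natAbs) ≤ (kq + 3) * Zmax := fun j => Nat.mul_le_mul_left _ (hZ du j)
  have hbase : cC * ((y 0).natAbs + (y 1).natAbs) + dC + (kq + 3) * Zmax + 3 ≤ E := by linarith [hdrift, hmul, hE₀Z]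
  have hDQ : ∀ j, cC * ((y 0).natAbs + (y 1).natAbs) + dC + (kq + 3) * (((zB du j) 0).natAbs + ((zB du j) 1).natAbs) + 1 ≤ Λ.rQ α y :=
    fun j => by rw [hEQ]; linarith [hbase, hZj j]
  have hDρ : ∀ j ℓ, cC * ((y 0).natAbs + (y 1).natAbs) + dC + (kq + 3) * (((zB du j) 0).natAbs + ((zB du j) 1).natAbs) + 1 ≤ Λ.ρ β y du ℓ :=
    fun j ℓ => by rw [hρ ℓ]; exact Nat.le_sub_of_add_le (by linarith [hbase, hZj j])
  have hρM : ∀ ℓ, Λ.ρ β y du ℓ + 1 ≤ Λ.rM β (y + stepVec du) := fun ℓ => by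
    rw [hρ ℓ, hM, Frad_succ]
    have := hgapL (Erad gap gap' E₀ (nQ α y))
    omega
  have hRexE : Rex (Erad gap gap' E₀ (nS α e.1) + 1) ≤ E - L' := by
    refine Nat.le_sub_of_add_le ?_
    rw [hEdef, hgen]
    exact hsch _
  -- deep entrances along the run
  have hc' : ((S.scheme₂ G).stN m ω).choice = some e := by rw [S.stN_eq₂]; exact hc
  have hdeep := deep_of_run₂ hlipF hws P t gap gap' E₀ L' off q δc hΛ hF0 hgap hgapc hoff hE₀1 hcol ω m hc' hdu β
  -- the records of the scheme
  have hL := levelGeomSG₂ P t hΛ hlipF (Λ := Λ)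
  have hQ : QSepGeom G S.Γ := qSepGeomSG₂ P t hlipF (Λ := Λ)
  have hSt := stepsGeomSG₂ P t hΛ hlipF hws (Λ := Λ)
  have hEx := exitGeomSG₂ P t hΛ hlipF (Λ := Λ)
  -- the habitat, the two windows, the two frames
  set Ω := S.Γ.Ewv α e.1 e.2 ∪ FD.Hfull β y du with hΩdef
  set c₀ := cOf α y with hc₀def
  have hlipR : Lip G (runX φ c₀ n h 1) := lip_runX hlipφ (Or.inl rfl) hn c₀ h
  set 𝒲₁ := planarWindowIn hlipF Ω with h𝒲₁def
  set 𝒲₂ := planarWindowIn hlipR Ω with h𝒲₂def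
  set S₁f := (P₁.scheduleNz 1 (P.cen y) hP₁ z).toFrame with hS₁fdef
  set S₂f := (corrRunSchedS P₂ hP₂ (B du) du.1 (sgOf_sign du) (hB du) (heb du) (hR' du) (hjoin du) (hreg du)).toFrame with hS₂fdef
  -- the column vertex lies in the habitat
  have hc₀Ω : c₀ ∈ Ω := by
    have : c₀ ∈ S.Γ.Q α y := hcQ α y
    exact Finset.mem_union_left _ (by rw [CellGeom.Ewv]; exact Finset.mem_union_right _ this)
  -- the run-frame rooms from the reading inequalities
  have hroom₂ := room₂_of_rd (φ := φ) (t₀ := t) (c₀ := c₀) (s₀ := s₀) (s₁ := s₁) (P := P) (y := y) (du := du) hA.le hn hm.le hc₀'.le hc₁'.le hD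
    (hcF α y) P₂ (hrd₂ du)
  have hroomB := roomB_of_rd (φ := φ) (t₀ := t) (c₀ := c₀) (s₀ := s₀) (s₁ := s₁) (P := P) (y := y) (du := du) hA.le hn hm.le hc₀'.le hc₁'.le hD
    (hcF α y) (B du) du.1 (sgOf du) (hrdB du)
  have hroomL := roomL_of_rd (φ := φ) (t₀ := t) (c₀ := c₀) (s₀ := s₀) (s₁ := s₁) (P := P) (y := y) (du := du) hA.le hn hm.le hc₀'.le hc₁'.le hD
    (hcF α y) (B du) du.1 (sgOf du) (hrdL du)
  -- the two window-chain records: rims = far vertices of the regions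
  let C₁ : WinChainData V :=
    { Rlev := Rlev, N := Nk, j₀ := j₀, j₁ := j₁, o := t, Sfin := S.Sx G (S.hst₂ G ω m) e α β du,
      Rim := fun k => (𝒲₁.stepDF S₁f k).filter fun v => v ∉ graphBall G t (E - L') }
  let C₂ : WinChainData V :=
    { Rlev := Rlev, N := Nk, j₀ := j₀, j₁ := j₁, o := t, Sfin := S.Sx G (S.hst₂ G ω m) e α β du,
      Rim := fun k => (𝒲₂.stepDF S₂f k).filter fun v => v ∉ graphBall G t (E - L') }
  have hRimD₁ : ∀ k, C₁.Rim k ⊆ 𝒲₁.stepDF S₁f k := fun k => Finset.filter_subset _ _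
  have hRimD₂ : ∀ k, C₂.Rim k ⊆ 𝒲₂.stepDF S₂f k := fun k => Finset.filter_subset _ _
  have hRimfar₁ : ∀ k, ∀ v ∈ C₁.Rim k, v ∉ graphBall G t (E - L') := fun k v hv => (Finset.mem_filter.1 hv).2
  have hRimfar₂ : ∀ k, ∀ v ∈ C₂.Rim k, v ∉ graphBall G t (E - L') := fun k v hv => (Finset.mem_filter.1 hv).2
  -- the regions lie in the habitat proper `Q_α(y) ∪ E^far_β`
  have hDΩ₁ : ∀ k, 𝒲₁.stepDF S₁f k ⊆ Ω := fun k v hv => ((mem_WinIn (φ := fineSkel φ t A n h vα vβ c₀' c₁' s₀ s₁ D)).1 hv).1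
  have hDΩ₂ : ∀ k, 𝒲₂.stepDF S₂f k ⊆ Ω := fun k v hv => ((mem_WinIn (φ := runX φ c₀ n h 1)).1 hv).1
  have hN₁ : S₁f.N = P₁.N := rfl
  have hN₂ : S₂f.N = P₂.N + 1 + (B du).N := rfl
  have hDh₁ : ∀ k ≤ S₁f.N, 𝒲₁.stepDF S₁f k ⊆ S.Γ.Q α y ∪ S.Γ.Efar β y du := by
    intro k hk v hv
    obtain ⟨hvΩ, hvF⟩ := (mem_WinIn (φ := fineSkel φ t A n h vα vβ c₀' c₁' s₀ s₁ D)).1 hv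
    have hvF' : fineSkel φ t A n h vα vβ c₀' c₁' s₀ s₁ D v ∈ (P₁.scheduleNz 1 (P.cen y) hP₁ z).region k := hvF
    have hk' : k ≤ P₁.N := by rw [hN₁] at hk; exact hk
    exact mem_Q_union_Efar_of_mem_habΩ₂ hSt hV.anch hdur hvΩ
      (Finset.mem_union_left _ (phase1z_region_subset_Q P y P₁ hP₁ z h5r₁ h5r₀ hk' hvF'))
  have hDh₂ : ∀ k ≤ S₂f.N, 𝒲₂.stepDF S₂f k ⊆ S.Γ.Q α y ∪ S.Γ.Efar β y du := by
    intro k hk v hv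
    obtain ⟨hvΩ, hvR⟩ := (mem_WinIn (φ := runX φ c₀ n h 1)).1 hv
    have hvR' : runX φ c₀ n h 1 v ∈ (corrRunSchedS P₂ hP₂ (B du) du.1 (sgOf_sign du) (hB du) (heb du) (hR' du) (hjoin du) (hreg du)).region k :=
      hvR
    rw [hN₂] at hk
    refine mem_Q_union_Efar_of_mem_habΩ₂ hSt hV.anch hdur hvΩ ?_
    rcases corrRunSchedS_region_cases P₂ hP₂ (B du) du.1 (sgOf_sign du) (hB du) (heb du) (hR' du) (hjoin du) (hreg du) hk with
      ⟨hk', hrg⟩ | ⟨j, hj', -, hrg⟩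
    · rw [hrg] at hvR'; exact hroom₂ k hk' v hvR'
    · rw [hrg] at hvR'; exact hroomB j hj' v hvR'
  -- the rim excess of the two chains
  have hexc₁ : ∀ k ≤ S₁f.N, (prodBernoulli (S.Wcor G FD (S.hst₂ G ω m) e α β du)).real (⋃ t' ∈ C₁.Rim k, openConn t t') ≤ η := by
    intro k hk
    exact real_rim_le_concSG₂ hlipF hws hΛ hV hV.anch hdu hEQ hBle hρle hdeep (hRex _) hRexE ((hRimD₁ k).trans (hDΩ₁ k))
      ((hRimD₁ k).trans (hDh₁ k hk)) (hRimfar₁ k)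
  have hexc₂ : ∀ k ≤ S₂f.N, (prodBernoulli (S.Wcor G FD (S.hst₂ G ω m) e α β du)).real (⋃ t' ∈ C₂.Rim k, openConn t t') ≤ η := by
    intro k hk
    exact real_rim_le_concSG₂ hlipF hws hΛ hV hV.anch hdu hEQ hBle hρle hdeep (hRex _) hRexE ((hRimD₂ k).trans (hDΩ₂ k))
      ((hRimD₂ k).trans (hDh₂ k hk)) (hRimfar₂ k)
  -- the kit clauses at this run
  have hkits₁ := hkitsR₁ ω m e hc hV du hdu C₁ rfl rfl rfl rfl rfl rfl (fun k v hv hfar => Finset.mem_filter.2 ⟨hv, hfar⟩)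
  have hkits₂ := hkitsR₂ ω m e hc hV du hdu C₂ rfl rfl rfl rfl rfl rfl (fun k v hv hfar => Finset.mem_filter.2 ⟨hv, hfar⟩)
  -- the true targets are nonempty
  have hTne₁ : ∀ k ≤ S₁f.N, (𝒲₁.coreTF S₁f k).Nonempty := fun k _ =>
    coreTF₁_nonempty hlipF P₁ hP₁ z hc₀Ω (hcF α y) k
  have hTne₂ : ∀ k ≤ S₂f.N, (𝒲₂.coreTF S₂f k).Nonempty := by
    intro k hk
    refine coreTF₂_nonempty hlipR hc₀Ω P₂ hP₂ (B du) du.1 (sgOf_sign du) (hB du) (heb du) (hR' du) (hjoin du) (hreg du) ?_ hk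
    intro j hj1 hjN
    obtain ⟨h1, h2, h3⟩ := hrdZ du j
    obtain ⟨g, hg, hgz⟩ := exists_mem_span_runX_eq (s₀ := s₀) (s₁ := s₁) (P := P) (Λ := Λ) (α := α) (a' := β) (y := y) (du := du)
      hstep hA.le hn hm.le hc₀'.le hc₁'.le hD hκ hlipF hws (hcF α y) (hcD α y) (zB du j) (hDQ j) (hDρ j) h1 h2 h3
    exact ⟨g, Q_union_HfullSpan_subset_habΩ₂ hg, by rw [hgz]; exact hzB du j hj1 hjN⟩
  -- assemble
  exact reachOblAtHN_negCorridor hA hn hm hc₀' hc₁' hD _ rfl hlipF c₀ (runX φ c₀ n h 1) rfl hlipR S rfl FD rfl hL hQ hSt hEx hV hV.anch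
    hdu hdur Ω rfl (hcF α y) P₁ hP₁ z h3r₁ h3r₀ h5r₁ h5r₀ P₂ hP₂ (B du) du.1 (sgOf_sign du) (hB du) (heb du) (hR' du) (hjoin du) (hreg du)
    (hcoreK y) ha hBx hb hroom₂ hroomB hroomL hρM (hlen du) S₁f S₂f rfl rfl C₁ C₂ rfl rfl rfl rfl hRimD₁ hRimD₂
    (by show Rlev + 1 ≤ P₁.e - z; exact hRl₁) (by show Rlev + 1 ≤ P₂.e; exact hRl₂) hj hj hTne₁ hTne₂ hcount hcount hkits₁ hkits₂ hη
    hexc₁ hexc₂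

end Skelφ

end Transplant

end Summit.CriticalPhenomena.PercolationContinuityZ3.Theorems

end
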